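import Summits.MatrixMultiplication.MatrixMultiplication.Theorems.OutsiderSandwichContactFace
/-!
# OutsiderSandwich — the CONTACT ANGLE at the gauge corner, and necessity of the contact-face pieces

Route `route-MatrixMultiplication-OutsiderSandwich` (decomp-mm lens 4, generation 15); sequel to
`OutsiderSandwichContactFace` (notation there: `τ_F`, `x_F`, the laser floor `Λ`, the contact face
`T = touchingExponents`, `τ* = sSup T`).  Cut of record unchanged.

§1 THE CONTACT ANGLE.  `SharpCornerAngle` : `∃ ε > 0, σ > 1/3: τ_F < 2+ε ⟹ x_F ≥ log₂3 + σ(τ_F − 2)`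
   (the lower boundary of the pair spectrum leaves the corner at a slope STRICTLY above the floor's
   `1/3`).  `SharpCornerAngle ⟹ CornerIsolation` (`cornerIsolation_of_sharpCornerAngle`);
   `PerfectBeyondLaser ⟹` the GLOBAL angle `x_F ≥ log₂3 + (1/3+γ)(τ_F − 2)` for all `F`
   (`lntFloor`, the LNT floor) `⟹ SharpCornerAngle`; and `CwTwoMMPerfect ⟹ SharpCornerAngle`
   (through the tree's `perfectBeyondLaser_of_cwTwoMMPerfect`).  So the local piece is the weakest
   exclusion statement of the node: `TOP ⟹ LNT ⟹ SharpCornerAngle ⟹ CornerIsolation ⟸ LaserTangency`.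

§2 NECESSITY.  Every piece follows from `ω = 2` (`pairStarConvex_of_summit`, `sharpCornerAngle_of_summit`,
   `cornerIsolation_of_summit`, `ordConnected_of_summit`): the node consists of CONSEQUENCES of the
   summit, banked as asides; the cut of record is unchanged.

References: Strassen, J. reine angew. Math. 384 (1988) Thm. 2.3–2.4, 3.8; Strassen, J. reine angew.
Math. 413 (1991) §6; Christandl–Vrana–Zuiddam, J. AMS 36 (2023) Prop. 1.6, Cor. 3.31, Thm. 4.20;
Coppersmith–Winograd, JSC 9 (1990) §6–7; Bürgisser–Clausen–Shokrollahi (1997) 15.3, 15.41;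
Alman–Li–Pratt, arXiv:2604.01386 §8 (edges of the matrix-multiplication spectrum).
-/

-- the problem's namespace `Summit.MatrixMultiplication.MatrixMultiplication` repeats the summit name
set_option linter.dupNamespace false

namespace Summit.MatrixMultiplication.MatrixMultiplication.Theorems.OutsiderSandwichCornerAngle

open scoped Topology
open Filter
open Literature.Computability.AlgebraicComplexity
open Literature.Barriers.MatrixMultiplication (flatteningRank_cwTensor)
open Summit.MatrixMultiplication.MatrixMultiplication.Theses.OutsiderSandwich
open Summit.MatrixMultiplication.MatrixMultiplication.Theorems.OutsiderSandwichLaserFloor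
  (one_le_map_matMulTensor two_le_matExp laserFloor rpow_matExp_le_map_matMulTensor)
open Summit.MatrixMultiplication.MatrixMultiplication.Theorems.OutsiderSandwichLaserFloorCut
  (matExp_le_omega three_le_map_cwTensor)
open Summit.MatrixMultiplication.MatrixMultiplication.Theorems.OutsiderSandwichSpectralTransfer
  (map_unitTensor)
open Summit.MatrixMultiplication.MatrixMultiplication.Theorems.OutsiderSandwichPackingProfileLaser
  (perfectBeyondLaser_of_cwTwoMMPerfect)
open Summit.MatrixMultiplication.MatrixMultiplication.Theorems.OutsiderSandwichLaserTangency
  (laserTangency_of_summit)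
open Summit.MatrixMultiplication.MatrixMultiplication.Theorems.OutsiderSandwichTouchingExponent
  (touchingExponents touchingExponents_subset_Icc bddAbove_touchingExponents
    isCompact_touchingExponents two_mem_touchingExponents_of laserTangency_iff_subset_two
    laserMergeOptimal_iff_omega_mem laserTangency_iff_sSup_le laserMergeOptimal_iff_sSup_eq
    sSup_touchingExponents_le_omega)

variable {F : SpectralMap ℂ}
open Summit.MatrixMultiplication.MatrixMultiplication.Theorems.OutsiderSandwichContactFace

/-! ## §1  The contact angle at the corner -/

/-- **`SharpCornerAngle ⟹ CornerIsolation`**: if near the corner every universal point satisfies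
`x_F ≥ log₂3 + σ(τ_F − 2)` with `σ > 1/3`, then no touching point has `2 < τ_F < 2 + ε`.
[cite: Strassen1988, Thm. 2.3] -/
theorem cornerIsolation_of_sharpCornerAngle
    (h : ∃ ε σ : ℝ, 0 < ε ∧ 1 / 3 < σ ∧ ∀ F : SpectralMap ℂ, IsUniversalSpectralPoint ℂ F →
      Real.logb 2 (F (matMulTensor ℂ 2 2 2)) < 2 + ε →
      Real.logb 2 3 + σ * (Real.logb 2 (F (matMulTensor ℂ 2 2 2)) - 2) ≤
        Real.logb 2 (F (cwTensor ℂ 2))) :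
    ∃ ε : ℝ, 0 < ε ∧ ∀ F : SpectralMap ℂ, IsUniversalSpectralPoint ℂ F →
        Real.logb 2 (F (matMulTensor ℂ 2 2 2)) < 2 + ε →
        Real.logb 2 (F (cwTensor ℂ 2)) =
          Real.logb 2 3 + (Real.logb 2 (F (matMulTensor ℂ 2 2 2)) - 2) / 3 →
        Real.logb 2 (F (matMulTensor ℂ 2 2 2)) = 2 := by
  obtain ⟨ε, σ, hε, hσ, h⟩ := h
  refine ⟨ε, hε, fun G hG hlt hGx => ?_⟩
  have h1 := h G hG hlt
  rw [hGx] at h1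
  have hτ2 := two_le_matExp hG
  by_contra hne
  have hgt : 2 < Real.logb 2 (G (matMulTensor ℂ 2 2 2)) := lt_of_le_of_ne hτ2 (Ne.symm hne)
  have hpos : 0 < (σ - 1 / 3) * (Real.logb 2 (G (matMulTensor ℂ 2 2 2)) - 2) :=
    mul_pos (sub_pos.2 hσ) (sub_pos.2 hgt)
  nlinarith [h1, hpos]

/-- **The LNT floor, multiplicative form.**  A family of perfect packings with block side
`≥ 2^{(1/3+γ)N}` (the letter of `PerfectBeyondLaser` at excess `γ`) gives, for every universal
spectral point, `3 · 2^{(1/3+γ)(τ_F − 2)} ≤ F(cw₂)` — the laser floor with slope `1/3 + γ`.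
Same proof as `laserFloor_mul` (apply `F` to the packing, take `N`-th roots, `ε → 0⁺`).
[cite: CoppersmithWinograd1990, §7; Strassen1988, Thm. 3.8] -/
theorem lntFloor_mul {γ : ℝ}
    (hP : ∀ ε : ℝ, 0 < ε → ∀ N₀ : ℕ, ∃ N : ℕ, N₀ ≤ N ∧ ∃ B m : ℕ,
      TensorRestrictsTo (kroneckerPow (cwTensor ℂ 2) N)
        (kroneckerTensor (unitTensor ℂ B) (matMulTensor ℂ m m m)) ∧
      (3 : ℝ) ^ ((1 - ε) * N) ≤ (B : ℝ) * (m : ℝ) ^ 2 ∧ (2 : ℝ) ^ ((1 / 3 + γ) * N) ≤ (m : ℝ))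
    (hF : IsUniversalSpectralPoint ℂ F) :
    3 * (2 : ℝ) ^ ((1 / 3 + γ) * (Real.logb 2 (F (matMulTensor ℂ 2 2 2)) - 2)) ≤ F (cwTensor ℂ 2) := by
  set τ := Real.logb 2 (F (matMulTensor ℂ 2 2 2)) with hτ
  have hτ2 : 2 ≤ τ := two_le_matExp hF
  have hF0 : 0 ≤ F (cwTensor ℂ 2) := hF.nonneg _
  have key : ∀ ε : ℝ, 0 < ε → ε < 1 →
      (3 : ℝ) ^ (1 - ε) * (2 : ℝ) ^ ((1 / 3 + γ) * (τ - 2)) ≤ F (cwTensor ℂ 2) := by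
    intro ε hε hε1
    obtain ⟨N, hN, B, m, hres, hcell, hm⟩ := hP ε hε 1
    have hm0 : (0 : ℝ) < m := lt_of_lt_of_le (Real.rpow_pos_of_pos two_pos _) hm
    have hm1 : 1 ≤ m := by
      rcases Nat.eq_zero_or_pos m with h | h
      · exfalso; rw [h] at hm0; simp at hm0
      · exact h
    have hPk := OutsiderSandwichLaserFloor.mul_rpow_le_pow_of_packing hF hm1 hres
    have hsplit : (m : ℝ) ^ τ = (m : ℝ) ^ 2 * (m : ℝ) ^ (τ - 2) := by
      rw [← Real.rpow_natCast (m : ℝ) 2, ← Real.rpow_add hm0]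
      congr 1; push_cast; ring
    have h1 : (3 : ℝ) ^ ((1 - ε) * N) * ((2 : ℝ) ^ ((1 / 3 + γ) * N)) ^ (τ - 2) ≤
        (B : ℝ) * (m : ℝ) ^ τ := by
      rw [hsplit, ← mul_assoc]
      exact mul_le_mul hcell (Real.rpow_le_rpow (by positivity) hm (by linarith))
        (by positivity) (by positivity)
    have e3 : (3 : ℝ) ^ ((1 - ε) * N) = ((3 : ℝ) ^ (1 - ε)) ^ N :=
      Real.rpow_mul_natCast (by norm_num) _ _
    have e2 : ((2 : ℝ) ^ ((1 / 3 + γ) * N)) ^ (τ - 2) = ((2 : ℝ) ^ ((1 / 3 + γ) * (τ - 2))) ^ N := by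
      rw [← Real.rpow_mul (by norm_num), ← Real.rpow_mul_natCast (by norm_num)]
      congr 1; ring
    rw [e3, e2, ← mul_pow] at h1
    have h2 : ((3 : ℝ) ^ (1 - ε) * (2 : ℝ) ^ ((1 / 3 + γ) * (τ - 2))) ^ N ≤ F (cwTensor ℂ 2) ^ N :=
      h1.trans hPk
    exact le_of_pow_le_pow_left₀ (by omega) hF0 h2
  have hlim : Tendsto (fun ε : ℝ => (3 : ℝ) ^ (1 - ε) * (2 : ℝ) ^ ((1 / 3 + γ) * (τ - 2))) (𝓝[>] 0)
      (𝓝 ((3 : ℝ) ^ (1 - (0 : ℝ)) * (2 : ℝ) ^ ((1 / 3 + γ) * (τ - 2)))) := by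
    have hc : ContinuousAt (fun x : ℝ => (3 : ℝ) ^ x) (1 - 0) :=
      Real.continuousAt_const_rpow (by norm_num)
    have ht : Tendsto (fun ε : ℝ => 1 - ε) (𝓝[>] 0) (𝓝 (1 - 0)) :=
      (tendsto_const_nhds.sub tendsto_id).mono_left nhdsWithin_le_nhds
    exact (hc.tendsto.comp ht).mul_const _
  rw [sub_zero, Real.rpow_one] at hlim
  refine le_of_tendsto hlim ?_
  filter_upwards [Ioo_mem_nhdsGT (zero_lt_one' ℝ)] with ε hε using key ε hε.1 hε.2

/-- **The LNT floor**: under the letter of `PerfectBeyondLaser` at excess `γ`, every universal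
spectral point satisfies `log₂3 + (1/3 + γ)(τ_F − 2) ≤ x_F` — a GLOBAL contact angle `1/3 + γ`
(`γ = 0` is the laser floor itself). [cite: CoppersmithWinograd1990, §7; Strassen1988, Thm. 3.8] -/
theorem lntFloor {γ : ℝ}
    (hP : ∀ ε : ℝ, 0 < ε → ∀ N₀ : ℕ, ∃ N : ℕ, N₀ ≤ N ∧ ∃ B m : ℕ,
      TensorRestrictsTo (kroneckerPow (cwTensor ℂ 2) N)
        (kroneckerTensor (unitTensor ℂ B) (matMulTensor ℂ m m m)) ∧
      (3 : ℝ) ^ ((1 - ε) * N) ≤ (B : ℝ) * (m : ℝ) ^ 2 ∧ (2 : ℝ) ^ ((1 / 3 + γ) * N) ≤ (m : ℝ))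
    (hF : IsUniversalSpectralPoint ℂ F) :
    Real.logb 2 3 + (1 / 3 + γ) * (Real.logb 2 (F (matMulTensor ℂ 2 2 2)) - 2) ≤
      Real.logb 2 (F (cwTensor ℂ 2)) := by
  have h := lntFloor_mul hP hF
  have hC0 : 0 < (2 : ℝ) ^ ((1 / 3 + γ) * (Real.logb 2 (F (matMulTensor ℂ 2 2 2)) - 2)) :=
    Real.rpow_pos_of_pos two_pos _
  calc Real.logb 2 3 + (1 / 3 + γ) * (Real.logb 2 (F (matMulTensor ℂ 2 2 2)) - 2)
      = Real.logb 2 (3 * (2 : ℝ) ^ ((1 / 3 + γ) * (Real.logb 2 (F (matMulTensor ℂ 2 2 2)) - 2))) := by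
        rw [Real.logb_mul (by norm_num) hC0.ne', Real.logb_rpow two_pos (by norm_num)]
    _ ≤ Real.logb 2 (F (cwTensor ℂ 2)) :=
        Real.logb_le_logb_of_le one_lt_two (by positivity) h

/-- **`PerfectBeyondLaser ⟹ SharpCornerAngle`** (indeed with the global angle `σ = 1/3 + γ` and any
`ε`). [cite: CoppersmithWinograd1990, §7] -/
theorem sharpCornerAngle_of_perfectBeyondLaser (h : PerfectBeyondLaser) :
    ∃ ε σ : ℝ, 0 < ε ∧ 1 / 3 < σ ∧ ∀ F : SpectralMap ℂ, IsUniversalSpectralPoint ℂ F →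
      Real.logb 2 (F (matMulTensor ℂ 2 2 2)) < 2 + ε →
      Real.logb 2 3 + σ * (Real.logb 2 (F (matMulTensor ℂ 2 2 2)) - 2) ≤
        Real.logb 2 (F (cwTensor ℂ 2)) := by
  obtain ⟨γ, hγ, hP⟩ := h
  exact ⟨1, 1 / 3 + γ, one_pos, by linarith, fun G hG _ => lntFloor hP hG⟩

/-- **`CwTwoMMPerfect ⟹ SharpCornerAngle`** (TOP ⟹ LNT ⟹ global angle `5/12`).
[cite: CoppersmithWinograd1990, §6–7] -/
theorem sharpCornerAngle_of_cwTwoMMPerfect (h : CwTwoMMPerfect) :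
    ∃ ε σ : ℝ, 0 < ε ∧ 1 / 3 < σ ∧ ∀ F : SpectralMap ℂ, IsUniversalSpectralPoint ℂ F →
      Real.logb 2 (F (matMulTensor ℂ 2 2 2)) < 2 + ε →
      Real.logb 2 3 + σ * (Real.logb 2 (F (matMulTensor ℂ 2 2 2)) - 2) ≤
        Real.logb 2 (F (cwTensor ℂ 2)) :=
  sharpCornerAngle_of_perfectBeyondLaser (perfectBeyondLaser_of_cwTwoMMPerfect h)

/-- **`PerfectBeyondLaser ⟹ CornerIsolation`** (through the angle). [cite: CoppersmithWinograd1990, §7] -/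
theorem cornerIsolation_of_perfectBeyondLaser (h : PerfectBeyondLaser) :
    ∃ ε : ℝ, 0 < ε ∧ ∀ F : SpectralMap ℂ, IsUniversalSpectralPoint ℂ F →
        Real.logb 2 (F (matMulTensor ℂ 2 2 2)) < 2 + ε →
        Real.logb 2 (F (cwTensor ℂ 2)) =
          Real.logb 2 3 + (Real.logb 2 (F (matMulTensor ℂ 2 2 2)) - 2) / 3 →
        Real.logb 2 (F (matMulTensor ℂ 2 2 2)) = 2 :=
  cornerIsolation_of_sharpCornerAngle (sharpCornerAngle_of_perfectBeyondLaser h)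

/-! ## §2  Necessity: every piece of the node follows from `ω = 2` -/

/-- Under `ω = 2` every universal spectral point has `τ_F = 2`. [cite: Strassen1988, Thm. 2.4] -/
theorem matExp_eq_two_of_summit (hS : _root_.MatrixMultiplication) (hF : IsUniversalSpectralPoint ℂ F) :
    Real.logb 2 (F (matMulTensor ℂ 2 2 2)) = 2 := by
  have hω : omega ℂ = 2 := (_root_.MatrixMultiplication_iff).1 hS
  have h1 := matExp_le_omega hF
  rw [hω] at h1
  exact le_antisymm h1 (two_le_matExp hF)

/-- Under `ω = 2`, `F⟨2,2,2⟩ = 4` for every universal spectral point. [cite: Strassen1988, Thm. 2.4] -/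
theorem map_matMulTensor_two_eq_four_of_summit (hS : _root_.MatrixMultiplication)
    (hF : IsUniversalSpectralPoint ℂ F) : F (matMulTensor ℂ 2 2 2) = 4 := by
  have hpos : 0 < F (matMulTensor ℂ 2 2 2) :=
    lt_of_lt_of_le one_pos (one_le_map_matMulTensor hF (by norm_num))
  have h := matExp_eq_two_of_summit hS hF
  calc F (matMulTensor ℂ 2 2 2) = (2 : ℝ) ^ Real.logb 2 (F (matMulTensor ℂ 2 2 2)) :=
        (Real.rpow_logb two_pos (by norm_num) hpos).symm
    _ = 4 := by rw [h]; norm_num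

/-- **`ω = 2 ⟹ PairStarConvexity`** (NEC): under `ω = 2` the gauge point `ζ₁` interpolates
everything (`ζ₁⟨2,2,2⟩ = 4 = 4^{1−λ}F⟨2,2,2⟩^λ`, `ζ₁(cw₂) = 3 ≤ 3^{1−λ}F(cw₂)^λ`).
[cite: Strassen1988, Thm. 3.8, 6.5] -/
theorem pairStarConvex_of_summit (hS : _root_.MatrixMultiplication) :
    ∀ F : SpectralMap ℂ, IsUniversalSpectralPoint ℂ F → ∀ l : ℝ, 0 ≤ l → l ≤ 1 →
      ∃ H : SpectralMap ℂ, IsUniversalSpectralPoint ℂ H ∧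
        H (matMulTensor ℂ 2 2 2) = (4 : ℝ) ^ (1 - l) * F (matMulTensor ℂ 2 2 2) ^ l ∧
        H (cwTensor ℂ 2) ≤ (3 : ℝ) ^ (1 - l) * F (cwTensor ℂ 2) ^ l := by
  intro G hG l hl0 hl1
  refine ⟨gaugePoint₁ ℂ, gaugePoint₁_isUniversalSpectralPoint ℂ, ?_, ?_⟩
  · rw [gaugePoint₁_matMulTensor_two, map_matMulTensor_two_eq_four_of_summit hS hG,
      ← Real.rpow_add (by norm_num : (0 : ℝ) < 4)]
    norm_num
  · rw [gaugePoint₁_cwTensor_two]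
    have h3 := three_le_map_cwTensor hG
    calc (3 : ℝ) = (3 : ℝ) ^ (1 - l) * (3 : ℝ) ^ l := by
          rw [← Real.rpow_add (by norm_num : (0 : ℝ) < 3)]; norm_num
      _ ≤ (3 : ℝ) ^ (1 - l) * G (cwTensor ℂ 2) ^ l :=
          mul_le_mul_of_nonneg_left (Real.rpow_le_rpow (by norm_num) h3 hl0) (by positivity)

/-- **`ω = 2 ⟹ SharpCornerAngle`** (NEC, with `ε = σ = 1`): under `ω = 2` every `τ_F = 2` and the
angle inequality reads `log₂3 ≤ x_F`. [cite: Strassen1988, Thm. 2.4, 3.8] -/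
theorem sharpCornerAngle_of_summit (hS : _root_.MatrixMultiplication) :
    ∃ ε σ : ℝ, 0 < ε ∧ 1 / 3 < σ ∧ ∀ F : SpectralMap ℂ, IsUniversalSpectralPoint ℂ F →
      Real.logb 2 (F (matMulTensor ℂ 2 2 2)) < 2 + ε →
      Real.logb 2 3 + σ * (Real.logb 2 (F (matMulTensor ℂ 2 2 2)) - 2) ≤
        Real.logb 2 (F (cwTensor ℂ 2)) := by
  refine ⟨1, 1, one_pos, by norm_num, fun G hG _ => ?_⟩
  rw [matExp_eq_two_of_summit hS hG, sub_self, mul_zero, add_zero]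
  exact Real.logb_le_logb_of_le one_lt_two (by norm_num) (three_le_map_cwTensor hG)

/-- `ω = 2 ⟹ CornerIsolation` (NEC, via `LaserTangency`). [cite: Strassen1988, Thm. 2.4] -/
theorem cornerIsolation_of_summit (hS : _root_.MatrixMultiplication) :
    ∃ ε : ℝ, 0 < ε ∧ ∀ F : SpectralMap ℂ, IsUniversalSpectralPoint ℂ F →
        Real.logb 2 (F (matMulTensor ℂ 2 2 2)) < 2 + ε →
        Real.logb 2 (F (cwTensor ℂ 2)) =
          Real.logb 2 3 + (Real.logb 2 (F (matMulTensor ℂ 2 2 2)) - 2) / 3 →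
        Real.logb 2 (F (matMulTensor ℂ 2 2 2)) = 2 :=
  cornerIsolation_of_laserTangency (laserTangency_of_summit hS)

/-- `ω = 2 ⟹ ContactFaceConnected` (NEC, via `LaserTangency`). [cite: Strassen1988, Thm. 2.4] -/
theorem ordConnected_of_summit (hS : _root_.MatrixMultiplication) : touchingExponents.OrdConnected :=
  ordConnected_of_laserTangency (laserTangency_of_summit hS)

/-! ## §3  By-name links to the route items (rev 19) -/

/-- edge: `SharpCornerAngle (27971) ⟹ CornerIsolation (27968)`. [cite: Strassen1988, Thm. 2.3] -/
theorem cornerIsolation_of_sharpCornerAngle' (h : SharpCornerAngle) : CornerIsolation :=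
  cornerIsolation_of_sharpCornerAngle h

/-- edge: `PerfectBeyondLaser (31793) ⟹ SharpCornerAngle (27971)`. [cite: CoppersmithWinograd1990, §7] -/
theorem sharpCornerAngle_of_perfectBeyondLaser' (h : PerfectBeyondLaser) : SharpCornerAngle :=
  sharpCornerAngle_of_perfectBeyondLaser h

/-- edge: `CwTwoMMPerfect (27896) ⟹ SharpCornerAngle (27971)`. [cite: CoppersmithWinograd1990, §6–7] -/
theorem sharpCornerAngle_of_cwTwoMMPerfect' (h : CwTwoMMPerfect) : SharpCornerAngle :=
  sharpCornerAngle_of_cwTwoMMPerfect h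

/-- NEC: `ω = 2 ⟹` all four open pieces of the contact-face node. [cite: Strassen1988, Thm. 2.4] -/
theorem pieces_of_summit (hS : _root_.MatrixMultiplication) :
    CornerIsolation ∧ ContactFaceConnected ∧ PairStarConvexity ∧ SharpCornerAngle :=
  ⟨cornerIsolation_of_summit hS, contactFaceConnected_iff.2 (ordConnected_of_summit hS),
    pairStarConvex_of_summit hS, sharpCornerAngle_of_summit hS⟩

end Summit.MatrixMultiplication.MatrixMultiplication.Theorems.OutsiderSandwichCornerAngle
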